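import Summits.QuantumFields.BalabanUV.Beta.GAN24.BornLambdaVertexTent
import Summits.QuantumFields.BalabanUV.Beta.GAN24.RespStepDecay
import Mathlib.Algebra.Order.Chebyshev

/-!
# `BalabanUV.Beta.GAN24.RespStepBlockMassLower` — binder row G-an2-4 ∕ (CONV-C), W-slot CT-W, route «WC-TL» ∕ «QR-LL», the located scalar K-LL-4′ (RULING
# R-gan24p1-g29-1 + A1, journal l.44562 ∕ l.44793; leaf-01 g67 R-1 l.44982 §5(a)): **THE (N1) CONSTANT IS AT LEAST ONE — THE RESPONSE COLUMN CANNOT BE SMALL ON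
# ITS OWN BLOCK**: constraint reproduction (`𝒬_L` of the column is the Kronecker datum, tree) forces a contour point with `|respStep| ≥ (L^{d+2})⁻¹` and a block
# ℓ²-mass `Σ_{contour pts} respStep² ≥ (L^{d+2})⁻¹`, for an2's undressed composite columns at every `(m, k)` and for the literal's dressed one-step columns

NOT IN PRINT; OUR BOOKKEEPING ([folklore] pigeonhole + Cauchy–Schwarz (`Finset.exists_le_of_sum_le`, `sq_sum_le_card_mul_sum_sq`) over the tree identities
`ResolventComposition.contourSum_Hcol ∕ contourSum_mul` (an5) and `BornLambdaVertexTent.contourSum_respStepBmSeq` (leaf-03); G-an2-4 formalisation swarm → CRUX TEAM (2),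
leaf prover `b2b-balaban-gan24-formalise-leaf-01`, gen 67).  HONEST FRAMING (cell contract, verbatim): «discharging `BetaPertH` makes Bałaban's UV stability
UNCONDITIONAL — a real constructive-QFT result; it is NOT the continuum limit and NOT the Clay problem.»  HONEST DEPENDENCY (verbatim): «continuum YM on T⁴ ⇐ BetaPertH ∧
nine spine estimates (0/9 proved); BetaPertH ⇐ (D1) ∧ (D4) ∧ CAP+tail; G-an2-4 gates asym, D1 and NE2/3/4.»

## Why
Every count of the (LT) row ∕ K-LL-4′ (the END's `hLT`, the (UUU) cell `LayerTransportUndressedThree`, the flux gain `ρ_Φ`) carries the kernel legs through leaf-12 ∕ leaf-02's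
(N1) envelope `|respStep (Lc^m) (Lc^(m+k+1)) μ z l w| ≤ C·((Lc^(k+1))^{d+2})⁻¹·e^{−κ₀‖quo (Lc^(k+1)) w − z‖}` — an UPPER bound with an existential `C`.  Whether smallness could
hide in `C` is answered here in the negative, as a kernel fact: the UNNORMALISED contour sum of the column over the `L^{d+2}` contour points of its own block is EXACTLY `1`
(constraint reproduction), so the mean is `(L^{d+2})⁻¹`, some contour point carries at least that much (`C·e^{0} ≥ 1`), and the sum of squares over the block is at least
`(L^{d+2})⁻¹` (Cauchy–Schwarz) — the ℓ²-mass that drives the DIAGONAL of the flux sandwich `Σ_p ℋ(p;x)·Φ̂(p,p)·ℋ(p;x)` (R-1 §5(b): what remains for a certified `ρ_Φ` at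
`d = 3` is only the FACE-LAYER share of this block mass, an engine number).
§1 generic pigeonhole ∕ Cauchy–Schwarz at total `1`; §2 an2's undressed composite columns (`contourSum_respStep_pow`, `exists_abs_respStep_ge`, `inv_le_sum_sq_respStep`);
§3 the literal's dressed one-step columns (`exists_abs_respStepBmSeq_ge`, `inv_le_sum_sq_respStepBmSeq`).
[folklore]; 0 cited facts, 0 `def`, 0 `def … : Prop`, 0 sorry.  Asserts NO upper bound, decides nothing about (Q-R) ∕ K-LL-4′; NEVER «G-an2-4 closed» as (CONV-C);
NOT D1, NOT `BetaPertH`, NOT continuum, NOT Clay.  2026-08-22; no existing file touched.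
-/

noncomputable section

open Finset
open scoped BigOperators
open Literature.MathematicalPhysics.QuantumFieldTheory
open Literature.MathematicalPhysics.QuantumFieldTheory.Balaban1983to89
open Literature.MathematicalPhysics.QuantumFieldTheory.Balaban1983to89.Beta
open AffineAveraging (Form1 Site box toSite contourSum unitVec)
open BalabanCompositeJets (respStep)
open ResolventComposition (Hcol contourSum_Hcol contourSum_mul)
open Summit.QuantumFields.BalabanUV.Beta.GAN24.RespStepDecay (card_box_mul_card_range)
open Summit.QuantumFields.BalabanUV.Beta.GAN24.RespStepConstraint (respStep_eq_contourSum_Hcol)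
open Summit.QuantumFields.BalabanUV.Beta.GAN24.RespStepBmDecompExact (respStepBmSeq)
open Summit.QuantumFields.BalabanUV.Beta.GAN24.BornLambdaVertexTent (contourSum_respStepBmSeq)

namespace Summit.QuantumFields.BalabanUV.Beta.GAN24.RespStepBlockMassLower

variable {d : ℕ}

/-! ## §1 Pigeonhole and Cauchy–Schwarz at total one -/

/-- [folklore] If a real family sums to `1` over a nonempty finite set, some member is at least `1/#s` in absolute value. -/
theorem exists_inv_card_le_abs {ι : Type*} {s : Finset ι} (hs : s.Nonempty) {f : ι → ℝ} (h : ∑ i ∈ s, f i = 1) :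
    ∃ i ∈ s, ((s.card : ℝ))⁻¹ ≤ |f i| := by
  have hcard : (0 : ℝ) < s.card := by exact_mod_cast hs.card_pos
  refine Finset.exists_le_of_sum_le (M := ℝ) (f := fun _ => ((s.card : ℝ))⁻¹) (g := fun i => |f i|) hs ?_
  rw [Finset.sum_const, nsmul_eq_mul, mul_inv_cancel₀ hcard.ne', ← h]
  exact (le_abs_self _).trans (Finset.abs_sum_le_sum_abs f s)

/-- [folklore] If a real family sums to `1` over a nonempty finite set, its sum of squares is at least `1/#s` (Cauchy–Schwarz). -/
theorem inv_card_le_sum_sq {ι : Type*} {s : Finset ι} (hs : s.Nonempty) {f : ι → ℝ} (h : ∑ i ∈ s, f i = 1) :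
    ((s.card : ℝ))⁻¹ ≤ ∑ i ∈ s, f i ^ 2 := by
  have hcard : (0 : ℝ) < s.card := by exact_mod_cast hs.card_pos
  have hcs := sq_sum_le_card_mul_sum_sq (s := s) (f := f)
  rw [h, one_pow] at hcs
  rw [inv_le_iff_one_le_mul₀ hcard]
  linarith

/-! ## §2 an2's undressed composite columns: constraint reproduction over the relative block -/

section Undressed

variable {Lc : ℕ} [NeZero Lc]

/-- [folklore] **CONSTRAINT REPRODUCTION OVER THE RELATIVE BLOCKING** (an5's `contourSum_Hcol` ⨾ `contourSum_mul`; the `k = 0` case is `RespStepConstraint.contourSum_respStep`):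
`𝒬_{Lc^(k+1)} (respStep (Lc^m) (Lc^(m+k+1)) μ z) l w = [w = z ∧ l = μ]`. -/
theorem contourSum_respStep_pow (m k : ℕ) (μ : Fin (d + 1)) (z : Site (d + 1)) (l : Fin (d + 1)) (w : Site (d + 1)) :
    contourSum (Lc ^ (k + 1)) (respStep (d := d) (Lc ^ m) (Lc ^ (m + k + 1)) μ z) l w = if w = z ∧ l = μ then 1 else 0 := by
  have hM : 0 < Lc ^ m := pow_pos (Nat.pos_of_ne_zero (NeZero.ne Lc)) m
  rw [respStep_eq_contourSum_Hcol, ← congrFun (congrFun (contourSum_mul (Lc ^ m) (Lc ^ (k + 1)) hM (Hcol (N := Lc ^ (m + k + 1)) (d := d) μ z)) l) w,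
    ← pow_add, show m + (k + 1) = m + k + 1 from rfl, contourSum_Hcol]

/-- [folklore] The contour sum at the source bond, written as ONE finite sum over the `(Lc^(k+1))^{d+2}` contour points, equals `1`. -/
theorem sum_contour_respStep_eq_one (m k : ℕ) (μ : Fin (d + 1)) (z : Site (d + 1)) :
    ∑ i ∈ box (d + 1) (Lc ^ (k + 1)) ×ˢ Finset.range (Lc ^ (k + 1)),
        respStep (d := d) (Lc ^ m) (Lc ^ (m + k + 1)) μ z μ (((Lc ^ (k + 1) : ℕ) : ℤ) • z + toSite i.1 + (i.2 : ℤ) • unitVec μ) = 1 := by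
  have h := contourSum_respStep_pow (d := d) (Lc := Lc) m k μ z μ z
  rw [if_pos ⟨rfl, rfl⟩] at h
  rw [← h]
  unfold AffineAveraging.contourSum
  rw [Finset.sum_product]

omit [NeZero Lc] in
/-- [folklore] The contour index set of the relative block is nonempty (`Lc ≠ 0`) and has `(Lc^(k+1))^{d+2}` points. -/
theorem card_contour (hLc : Lc ≠ 0) (k : ℕ) :
    (box (d + 1) (Lc ^ (k + 1)) ×ˢ Finset.range (Lc ^ (k + 1))).Nonempty ∧
      (((box (d + 1) (Lc ^ (k + 1)) ×ˢ Finset.range (Lc ^ (k + 1))).card : ℕ) : ℝ) = (((Lc ^ (k + 1) : ℕ) : ℝ)) ^ (d + 2) := by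
  have hL : 0 < Lc ^ (k + 1) := pow_pos (Nat.pos_of_ne_zero hLc) _
  refine ⟨?_, ?_⟩
  · refine Finset.Nonempty.product ?_ ⟨0, Finset.mem_range.2 hL⟩
    exact ⟨fun _ => 0, by simp [AffineAveraging.box, Fintype.mem_piFinset, hL]⟩
  · rw [Finset.card_product, Nat.cast_mul, card_box_mul_card_range]

/-- NOT IN PRINT; OUR BOOKKEEPING.  **THE (N1) CONSTANT IS AT LEAST ONE**: some contour point of the source block carries `|respStep (Lc^m) (Lc^(m+k+1)) μ z μ ·| ≥ ((Lc^(k+1))^{d+2})⁻¹`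
— so in leaf-12 ∕ leaf-02's envelope `C·((Lc^(k+1))^{d+2})⁻¹·e^{−κ₀‖quo L w − z‖}` (whose exponential is `≤ 1`) necessarily `C ≥ 1`, at every `(m, k)`. -/
theorem exists_abs_respStep_ge (m k : ℕ) (μ : Fin (d + 1)) (z : Site (d + 1)) :
    ∃ i ∈ box (d + 1) (Lc ^ (k + 1)) ×ˢ Finset.range (Lc ^ (k + 1)),
      ((((Lc ^ (k + 1) : ℕ) : ℝ)) ^ (d + 2))⁻¹
        ≤ |respStep (d := d) (Lc ^ m) (Lc ^ (m + k + 1)) μ z μ (((Lc ^ (k + 1) : ℕ) : ℤ) • z + toSite i.1 + (i.2 : ℤ) • unitVec μ)| := by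
  obtain ⟨hne, hcard⟩ := card_contour (d := d) (NeZero.ne Lc) k
  rw [← hcard]
  exact exists_inv_card_le_abs hne (sum_contour_respStep_eq_one m k μ z)

/-- NOT IN PRINT; OUR BOOKKEEPING.  **THE BLOCK ℓ²-MASS OF THE RESPONSE COLUMN IS AT LEAST `((Lc^(k+1))^{d+2})⁻¹`** (Cauchy–Schwarz on the reproduced constraint): the
sum of squares of `respStep (Lc^m) (Lc^(m+k+1)) μ z μ ·` over the contour points of the source block is `≥ ((Lc^(k+1))^{d+2})⁻¹` — the mass feeding the diagonal of the flux
sandwich cannot be smaller than that of the uniform profile. -/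
theorem inv_le_sum_sq_respStep (m k : ℕ) (μ : Fin (d + 1)) (z : Site (d + 1)) :
    ((((Lc ^ (k + 1) : ℕ) : ℝ)) ^ (d + 2))⁻¹
      ≤ ∑ i ∈ box (d + 1) (Lc ^ (k + 1)) ×ˢ Finset.range (Lc ^ (k + 1)),
          respStep (d := d) (Lc ^ m) (Lc ^ (m + k + 1)) μ z μ (((Lc ^ (k + 1) : ℕ) : ℤ) • z + toSite i.1 + (i.2 : ℤ) • unitVec μ) ^ 2 := by
  obtain ⟨hne, hcard⟩ := card_contour (d := d) (NeZero.ne Lc) k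
  rw [← hcard]
  exact inv_card_le_sum_sq hne (sum_contour_respStep_eq_one m k μ z)

end Undressed

/-! ## §3 The literal's dressed one-step columns -/

section Dressed

variable {Lc : ℕ} [NeZero Lc] {rr : Fin (d + 1) → ℕ} (hrr : rr ∈ box (d + 1) Lc)

include hrr in
/-- [folklore] The dressed one-step column reproduces the constraint as ONE finite sum over the `Lc^{d+2}` contour points (leaf-03's `contourSum_respStepBmSeq`). -/
theorem sum_contour_respStepBmSeq_eq_one (m : ℕ) (μ : Fin (d + 1)) (z : Site (d + 1)) :
    ∑ i ∈ box (d + 1) Lc ×ˢ Finset.range Lc,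
        respStepBmSeq (d := d) (toSite rr) Lc m μ z μ ((Lc : ℤ) • z + toSite i.1 + (i.2 : ℤ) • unitVec μ) = 1 := by
  have h := contourSum_respStepBmSeq (d := d) hrr m μ z μ z
  rw [if_pos ⟨rfl, rfl⟩] at h
  rw [← h]
  unfold AffineAveraging.contourSum
  rw [Finset.sum_product]

include hrr in
/-- NOT IN PRINT; OUR BOOKKEEPING.  **THE DRESSED ONE-STEP COLUMN IS NOT SMALL ON ITS BLOCK**: some contour point carries `|respStepBmSeq ρ Lc m μ z μ ·| ≥ (Lc^{d+2})⁻¹`. -/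
theorem exists_abs_respStepBmSeq_ge (m : ℕ) (μ : Fin (d + 1)) (z : Site (d + 1)) :
    ∃ i ∈ box (d + 1) Lc ×ˢ Finset.range Lc,
      (((Lc : ℕ) : ℝ) ^ (d + 2))⁻¹ ≤ |respStepBmSeq (d := d) (toSite rr) Lc m μ z μ ((Lc : ℤ) • z + toSite i.1 + (i.2 : ℤ) • unitVec μ)| := by
  obtain ⟨hne, hcard⟩ := card_contour (d := d) (NeZero.ne Lc) 0
  simp only [zero_add, pow_one] at hne hcard
  rw [← hcard]
  exact exists_inv_card_le_abs hne (sum_contour_respStepBmSeq_eq_one hrr m μ z)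

include hrr in
/-- NOT IN PRINT; OUR BOOKKEEPING.  **THE BLOCK ℓ²-MASS OF THE DRESSED ONE-STEP COLUMN IS AT LEAST `(Lc^{d+2})⁻¹`.** -/
theorem inv_le_sum_sq_respStepBmSeq (m : ℕ) (μ : Fin (d + 1)) (z : Site (d + 1)) :
    (((Lc : ℕ) : ℝ) ^ (d + 2))⁻¹
      ≤ ∑ i ∈ box (d + 1) Lc ×ˢ Finset.range Lc,
          respStepBmSeq (d := d) (toSite rr) Lc m μ z μ ((Lc : ℤ) • z + toSite i.1 + (i.2 : ℤ) • unitVec μ) ^ 2 := by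
  obtain ⟨hne, hcard⟩ := card_contour (d := d) (NeZero.ne Lc) 0
  simp only [zero_add, pow_one] at hne hcard
  rw [← hcard]
  exact inv_card_le_sum_sq hne (sum_contour_respStepBmSeq_eq_one hrr m μ z)

end Dressed

end Summit.QuantumFields.BalabanUV.Beta.GAN24.RespStepBlockMassLower

end
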